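import Summits.BirchSwinnertonDyer.BirchSwinnertonDyer.Theorems.CMKolyvaginAtInertTwoConjugationTypeAtTwo
import Summits.BirchSwinnertonDyer.BirchSwinnertonDyer.Theorems.CMKolyvaginAtInertTwoInertOrderSplittingHabitat
import Summits.BirchSwinnertonDyer.BirchSwinnertonDyer.Theorems.CMKolyvaginAtInertTwoInertOrderSplittingInputs
import HarnessLib

/-!
# Route `CMKolyvaginAtInertTwo`, crux `CMKolyvaginExactAtInertTwo` (stmt-BirchSwinnertonDyer-24277):
# the habitat splitting theorem for COMPLEX CONJUGATION — on `Δ < 0` the transported complex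
# conjugation is a transposition on `E_K[2]`, so `H¹(K, E_K[2^M])^{c} = (1+c_*)H¹` and
# `#S = (#S^{c})²` for every finite `c_*`-, `η_*`-stable subgroup, with ONLY `z` (a `3`-cycle on
# `E_K[2]` in `Γ_K`) and `√Δ ∈ K` left as inputs

Seat `bsd-line-cmk2-p1` g10 (cell `bsd-print-cf2`); helper (`--supports stmt-BirchSwinnertonDyer-24277`).
THEOREMS ONLY: no definition, no named fact, no `sorry`; no item is closed; BSD is not proved by this.
Memo `Cruxes/CMExactDescentAtTwo/MEMO-inert-order-splitting.md` §4; KERNEL-STATUS v9 §9 (a).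

* `fix_and_move_of_Δ_neg` — for `Δ_E < 0`, a complex conjugation `c₀ ∈ Γ_ℚ` and a number field `K`
  on which the transport `e c₀ e⁻¹` of `c₀` to `K̄` lifts `σ ∈ Aut(K/ℚ)` (imaginary quadratic `K`:
  `RatClosure.isLiftOfAut_absGaloisTransport_of_isImaginaryQuadratic`; normal `K`:
  `isLiftOfAut_restrictNormal_absGaloisTransport`): that lift FIXES a non-zero point of `E_K[2]` and
  MOVES one (g2's `exists_twoTorsion_smul_ne_of_Δ_neg` moved along `RatClosure.pointsEquiv`; the fixed
  point is `v + c₀v`).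
* `natCard_stable_eq_sq_of_complexConjugation` / `fixed_iff_exists_add_conjAct_of_complexConjugation` —
  the habitat theorems of `InertOrderSplittingHabitat` with the transposition hypotheses DISCHARGED.
* `exists_cmGenerator_splitting` — everything assembled from `j(E)` maximal CM with `d` odd, `Δ < 0`,
  `√Δ ∈ K`, `z`: an equivariant CM generator `η` on `E_K(K̄)` and, at every level `2^M`, its restriction
  `ηn` to `E_K[2^M]` such that every finite `σ_*`-, `η_*`-stable `S ≤ H¹(K, E_K[2^M])` has `#S = (#S^{σ})²`.

References: Lang, *Elliptic Functions*, Ch. 10 §4 [Lang1987]; Gross 1991 §3, §5 [GrossLMS1991];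
Silverman *AEC* III.§1 [SilvermanAEC2009].
-/

-- single-conjunct summit: `Summit.BirchSwinnertonDyer.BirchSwinnertonDyer.…` repeats the name by design
set_option linter.dupNamespace false
set_option autoImplicit false

noncomputable section

open scoped Classical

namespace Summit.BirchSwinnertonDyer.BirchSwinnertonDyer.Theorems.InertOrderSplittingHabitat

open WeierstrassCurve Field
open Literature.NumberTheory.EllipticCurves
open Literature.NumberTheory.GaloisRepresentations
open Summit.BirchSwinnertonDyer.BirchSwinnertonDyer.Theorems.KolyvaginEigenTwo
open Summit.BirchSwinnertonDyer.Rank1Residual.P2.CartanAtTwo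

variable (W : WeierstrassCurve ℚ) [W.IsElliptic] {K : Type} [Field K] [NumberField K]
variable {σ : K ≃ₐ[ℚ] K} {c₀ : absoluteGaloisGroup ℚ}

/-- **On `Δ < 0` the transported complex conjugation is a transposition on `E_K[2]`**: the lift
`e c₀ e⁻¹` of `σ` fixes a non-zero `2`-torsion point of `E_K(K̄)` (`θ(v + c₀v)`) and moves one (`θ v`,
with `c₀v ≠ v` from g2's `exists_twoTorsion_smul_ne_of_Δ_neg`, `θ = RatClosure.pointsEquiv`).
[cite: SilvermanAEC2009, III.1] [cite: GrossLMS1991, §3] -/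
theorem fix_and_move_of_Δ_neg (hΔ : W.Δ < 0) (hc₀ : IsComplexConjugation (Rat.castHom ℝ) c₀)
    (hτ : IsLiftOfAut σ (absGaloisTransport (K := ℚ) (L := K) c₀).toRingEquiv) :
    (∃ X₀ : geomPoints (W.baseChange K), X₀ ≠ 0 ∧ (2 : ℤ) • X₀ = 0 ∧ hτ.pointsMap W X₀ = X₀) ∧
      (∃ Y₁ : geomPoints (W.baseChange K), (2 : ℤ) • Y₁ = 0 ∧ hτ.pointsMap W Y₁ ≠ Y₁) := by
  obtain ⟨v, hv⟩ := exists_twoTorsion_smul_ne_of_Δ_neg W hΔ hc₀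
  set θ := RatClosure.pointsEquiv (K := K) W with hθ
  have hlift : ∀ P : geomPoints W, θ (c₀ • P) = hτ.pointsMap W (θ P) := fun P ↦
    RatClosure.pointsEquiv_smul_of_lift W hτ c₀ (fun _ ↦ rfl) P
  have h2v : (2 : ℤ) • (v : geomPoints W) = 0 := (mem_geomTorsion_iff W 2 _).mp v.2
  have hv' : c₀ • (v : geomPoints W) ≠ v := fun h ↦ hv (Subtype.ext (by
    rw [AddSubgroup.torsionBy.coe_smul]; exact h))
  have hcc : ∀ P : geomPoints W, c₀ • c₀ • P = P := fun P ↦ by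
    rw [← mul_smul, ← pow_two, hc₀.sq_eq_one, one_smul]
  refine ⟨⟨θ ((v : geomPoints W) + c₀ • (v : geomPoints W)), ?_, ?_, ?_⟩,
    ⟨θ (v : geomPoints W), ?_, ?_⟩⟩
  · -- `v + c₀v ≠ 0`
    intro h0
    rw [map_eq_zero_iff θ θ.injective, add_comm, add_eq_zero_iff_eq_neg,
      neg_eq_self_of_two_zsmul h2v] at h0
    exact hv' h0
  · rw [← map_zsmul, zsmul_add, ← smul_zsmul_geomPoints, h2v, smul_zero, add_zero, map_zero]
  · rw [← hlift, smul_add, hcc, add_comm]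
  · rw [← map_zsmul, h2v, map_zero]
  · rw [← hlift]
    exact fun h ↦ hv' (θ.injective h)

/-- **`#S = (#S^{σ})²` for complex conjugation** (`Δ < 0`): `natCard_stable_eq_sq_of_lift` with the
transposition hypotheses discharged by `fix_and_move_of_Δ_neg`. [cite: Lang1987, Ch. 10 §4, Remark] -/
theorem natCard_stable_eq_sq_of_complexConjugation (hΔ : W.Δ < 0)
    (hc₀ : IsComplexConjugation (Rat.castHom ℝ) c₀) (hσ : σ * σ = 1)
    (hτ : IsLiftOfAut σ (absGaloisTransport (K := ℚ) (L := K) c₀).toRingEquiv)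
    {η : AddMonoid.End (geomPoints (W.baseChange K))} {k₀ c : ℤ}
    (hrel : ∀ P : geomPoints (W.baseChange K), η (η P) + (2 * k₀ + 1) • η P = c • P) (hc : Odd c)
    (hη : ∀ (γ : absoluteGaloisGroup K) (P : geomPoints (W.baseChange K)), γ • η P = η (γ • P))
    {z : absoluteGaloisGroup K}
    (hz : ∀ P : geomPoints (W.baseChange K), (2 : ℤ) • P = 0 → z • P = P → P = 0)
    (M : ℕ) (ηn : geomTorsion (W.baseChange K) ((2 : ℤ) ^ M) →+ geomTorsion (W.baseChange K) ((2 : ℤ) ^ M))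
    (hηn : ∀ P : geomTorsion (W.baseChange K) ((2 : ℤ) ^ M), (ηn P : geomPoints (W.baseChange K)) = η P)
    (hηnG : ∀ (x : absoluteGaloisGroup K) (P : geomTorsion (W.baseChange K) ((2 : ℤ) ^ M)),
      ηn (ContinuousMonoidHom.id (absoluteGaloisGroup K) x • P) = x • ηn P)
    (S : AddSubgroup (galH1Torsion (W.baseChange K) ((2 : ℤ) ^ M)))
    (hSσ : ∀ x ∈ S, conjAct W σ _ x ∈ S)
    (hSη : ∀ x ∈ S, resH1Hom (ContinuousMonoidHom.id _) ηn hηnG x ∈ S) :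
    Nat.card S = Nat.card {x : S // conjAct W σ _ (x : galH1Torsion (W.baseChange K) ((2 : ℤ) ^ M)) = x} ^ 2 :=
  natCard_stable_eq_sq_of_lift W hσ hτ hrel hc hη hz (fix_and_move_of_Δ_neg W hΔ hc₀ hτ).1
    (fix_and_move_of_Δ_neg W hΔ hc₀ hτ).2 M ηn hηn hηnG S hSσ hSη

/-- **`H¹(K, E_K[2^M])^{σ} = (1 + σ_*) H¹(K, E_K[2^M])` for complex conjugation** (`Δ < 0`).
[cite: Lang1987, Ch. 10 §4, Remark] -/
theorem fixed_iff_exists_add_conjAct_of_complexConjugation (hΔ : W.Δ < 0)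
    (hc₀ : IsComplexConjugation (Rat.castHom ℝ) c₀) (hσ : σ * σ = 1)
    (hτ : IsLiftOfAut σ (absGaloisTransport (K := ℚ) (L := K) c₀).toRingEquiv)
    {η : AddMonoid.End (geomPoints (W.baseChange K))} {k₀ c : ℤ}
    (hrel : ∀ P : geomPoints (W.baseChange K), η (η P) + (2 * k₀ + 1) • η P = c • P) (hc : Odd c)
    (hη : ∀ (γ : absoluteGaloisGroup K) (P : geomPoints (W.baseChange K)), γ • η P = η (γ • P))
    {z : absoluteGaloisGroup K}
    (hz : ∀ P : geomPoints (W.baseChange K), (2 : ℤ) • P = 0 → z • P = P → P = 0)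
    (M : ℕ) (ηn : geomTorsion (W.baseChange K) ((2 : ℤ) ^ M) →+ geomTorsion (W.baseChange K) ((2 : ℤ) ^ M))
    (hηn : ∀ P : geomTorsion (W.baseChange K) ((2 : ℤ) ^ M), (ηn P : geomPoints (W.baseChange K)) = η P)
    (hηnG : ∀ (x : absoluteGaloisGroup K) (P : geomTorsion (W.baseChange K) ((2 : ℤ) ^ M)),
      ηn (ContinuousMonoidHom.id (absoluteGaloisGroup K) x • P) = x • ηn P)
    (x : galH1Torsion (W.baseChange K) ((2 : ℤ) ^ M)) :
    conjAct W σ _ x = x ↔ ∃ y, x = y + conjAct W σ _ y :=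
  fixed_iff_exists_add_conjAct_of_lift W hσ hτ hrel hc hη hz (fix_and_move_of_Δ_neg W hΔ hc₀ hτ).1
    (fix_and_move_of_Δ_neg W hΔ hc₀ hτ).2 M ηn hηn hηnG x

/-- **THE SPLITTING PACKAGE on the habitat data** (`j(E)` maximal CM with `d = cmDiscr j(E)` odd and
`4c = d(d−1)`, `c` odd; `Δ_E < 0`; `K` a number field with `√Δ_E ∈ K`; `σ ∈ Aut(K/ℚ)` an involution
lifted by a transported complex conjugation; `z ∈ Γ_K` without non-zero fixed point on `E_K[2]`):
there is a `Γ_K`-equivariant CM generator `η` on `E_K(K̄)` (`η² − dη = −c`) with restrictions `ηn` to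
every `E_K[2^M]`, such that EVERY finite `σ_*`-, `η_*`-stable `S ≤ H¹(K, E_K[2^M])` satisfies
`#S = (#S^{σ})²`. [cite: Lang1987, Ch. 10 §4, Remark] -/
theorem exists_cmGenerator_splitting (hj : W.j ∈ maximalCMJInvariants) {d c : ℤ}
    (hd : cmDiscr W.j = d) (hcd : d * (d - 1) = 4 * c) (hodd : Odd d) (hoddc : Odd c) (hΔ : W.Δ < 0)
    (hΔK : IsSquare (W.baseChange K).Δ) (hc₀ : IsComplexConjugation (Rat.castHom ℝ) c₀) (hσ : σ * σ = 1)
    (hτ : IsLiftOfAut σ (absGaloisTransport (K := ℚ) (L := K) c₀).toRingEquiv)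
    {z : absoluteGaloisGroup K}
    (hz : ∀ P : geomPoints (W.baseChange K), (2 : ℤ) • P = 0 → z • P = P → P = 0) :
    ∃ η : AddMonoid.End (geomPoints (W.baseChange K)),
      (∀ P : geomPoints (W.baseChange K), η (η P) + (-d) • η P = (-c) • P) ∧
      (∀ (γ : absoluteGaloisGroup K) (P : geomPoints (W.baseChange K)), γ • η P = η (γ • P)) ∧
      ∀ M : ℕ, ∃ ηn : geomTorsion (W.baseChange K) ((2 : ℤ) ^ M) →+ geomTorsion (W.baseChange K) ((2 : ℤ) ^ M),
        ∃ hηnG : ∀ (x : absoluteGaloisGroup K) (P : geomTorsion (W.baseChange K) ((2 : ℤ) ^ M)),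
            ηn (ContinuousMonoidHom.id (absoluteGaloisGroup K) x • P) = x • ηn P,
          (∀ P : geomTorsion (W.baseChange K) ((2 : ℤ) ^ M), (ηn P : geomPoints (W.baseChange K)) = η P) ∧
          ∀ S : AddSubgroup (galH1Torsion (W.baseChange K) ((2 : ℤ) ^ M)),
            (∀ x ∈ S, conjAct W σ _ x ∈ S) →
            (∀ x ∈ S, resH1Hom (ContinuousMonoidHom.id _) ηn hηnG x ∈ S) →
              Nat.card S =
                Nat.card {x : S // conjAct W σ _ (x : galH1Torsion (W.baseChange K) ((2 : ℤ) ^ M)) = x} ^ 2 := by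
  obtain ⟨η, hrel, hη⟩ := exists_cmGenerator_baseChange W hj hd hcd hodd hoddc K hΔK
  refine ⟨η, hrel, hη, fun M ↦ ?_⟩
  obtain ⟨ηn, hηn, hηnG⟩ := exists_torsionRestrict (W.baseChange K) η hη ((2 : ℤ) ^ M)
  refine ⟨ηn, hηnG, hηn, fun S hSσ hSη ↦ ?_⟩
  -- `m = -d = 2k₀ + 1` with `k₀ = -(d+1)/2`
  obtain ⟨r, hr⟩ := hodd
  have hrel' : ∀ P : geomPoints (W.baseChange K), η (η P) + (2 * (-r - 1) + 1) • η P = (-c) • P := by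
    intro P; rw [show (2 * (-r - 1) + 1 : ℤ) = -d by rw [hr]; ring]; exact hrel P
  exact natCard_stable_eq_sq_of_complexConjugation W hΔ hc₀ hσ hτ hrel' hoddc.neg hη hz M ηn hηn hηnG S hSσ hSη

end Summit.BirchSwinnertonDyer.BirchSwinnertonDyer.Theorems.InertOrderSplittingHabitat
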